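import Summits.BirchSwinnertonDyer.BirchSwinnertonDyer.Theorems.CyclotomicUntwistSigmaLineFamilySharpRadius
import Mathlib.Analysis.Normed.Group.Ultra
import HarnessLib

/-!
# Route `CyclotomicUntwist`, crux K1 `PSRankOneLowerHalfAtThree` (stmt-BirchSwinnertonDyer-21580):
# the σ-LINE FAMILY — EVALUATION AT THE BOUNDARY: `(exp(ε·log²))(z) = exp_p(ε·log(z)²)` and
# `‖log(z)‖ = ‖z‖` on the CLOSED disc `‖z‖ ≤ p⁻¹` (`p ≥ 3`, `‖ε‖ ≤ p`), by absolute double summability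

Cell `pub/bsd-wall` (D-0145 line `route-BirchSwinnertonDyer-CyclotomicUntwist`), seat `bsd-line-cycu-p1`
g4, lane «σ-LINE FAMILY LAW», file 20. THEOREMS ONLY; helper `--supports` K1 = stmt-BirchSwinnertonDyer-21580.
BSD is not proved by this file and no crux is.

WHY. `…SigmaLineFamilyEvaluation.padicEval_exp_formalLog_sq` evaluates the exp-factor of the family law
at `t = p·s`, `‖s‖ < 1` (level `v(z) ≥ 2`) through the tree's `padicEval_subst` for INTEGRAL series on the
OPEN unit disc. The census's admissible locus is `v(z) ≥ 1`, the boundary, where no rescaling makes the data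
integral. This file replaces the integral substitution lemma by a REARRANGEMENT THEOREM under absolute
double summability and verifies the summability with the `√p`-weights of `…SharpRadius`:

* **`padicEval_subst_eq_tsum`** — for `g(0) = 0`, `Σ‖gₙzⁿ‖ < ∞` and `Σ_{d,n} ‖f_d·[g^d]ₙ·zⁿ‖ < ∞`:
  `Σ‖[f∘g]ₙ zⁿ‖ < ∞` and `(f∘g)(z) = Σ_d f_d·g(z)^d` (Fubini on `ℕ × ℕ`, `padicEval_pow_of_summable_norm`);
* `norm_coeff_formalLog_le_weighted` (`‖[log]ₙ‖ ≤ √p^{n−1}`), `norm_coeff_eps_log_sq_le` (`‖[ε·log²]ₙ‖ ≤ √pⁿ`),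
  `coeff_pow_eps_log_sq_eq_zero` (`[tⁿ](ε log²)^d = 0`, `n < 2d`), the majorant `majorant d n =
  [2d ≤ n]·√p^d·(√p)⁻ⁿ` with its row sums `(√p)⁻ᵈ/(1 − (√p)⁻¹)` and `summable_majorant`;
* **`norm_padicEval_formalLog_of_norm_le`** — `‖log_V(z)‖ = ‖z‖` for `‖z‖ ≤ p⁻¹`;
* **`padicEval_exp_formalLog_sq_of_norm_le`** — `(exp(ε log_V²))(z) = exp_p(ε·log_V(z)²)`, with
  `summable_norm_exp_formalLog_sq_of_norm_le`, `padicLog_padicEval_exp_formalLog_sq_of_norm_le`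
  (`log_p` of it `= ε·log_V(z)²`), `padicEval_exp_formalLog_sq_ne_zero_of_norm_le`.

References: Robert 2000 Ch. V §4; Bernardi 1981 §1; Silverman AEC IV.6. [cite: Robert2000PadicAnalysis, Ch. V
§4.2 Proposition 3] [cite: SilvermanAEC2009, IV.6.4]
-/

set_option autoImplicit false
-- single-conjunct summit: `Summit.BirchSwinnertonDyer.BirchSwinnertonDyer.…` repeats the name by design
set_option linter.dupNamespace false

noncomputable section

open scoped Classical Nat

open PowerSeries WeierstrassCurve Literature.NumberTheory.EllipticCurves Literature.RingTheory.FormalGroups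
  Literature.NumberTheory.LocalFields

namespace Summit.BirchSwinnertonDyer.BirchSwinnertonDyer.Theorems.PSSigmaLineFamilyBoundaryEvaluation

open Summit.BirchSwinnertonDyer.BirchSwinnertonDyer.Theorems.PSSigmaLineFamily
  Summit.BirchSwinnertonDyer.BirchSwinnertonDyer.Theorems.PSSigmaLineFamilyEvaluation
  Summit.BirchSwinnertonDyer.BirchSwinnertonDyer.Theorems.PSSigmaLineFamilyValues
  Summit.BirchSwinnertonDyer.BirchSwinnertonDyer.Theorems.PSSigmaLineFamilySharpRadius

/-! ### §1 Rearrangement: evaluating `f ∘ g` beyond the integral regime -/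

section Rearrangement

variable {p : ℕ} [Fact p.Prime]

/-- Powers evaluate to powers under absolute convergence: `Σ‖[g^d]ₙzⁿ‖ < ∞` and `(g^d)(z) = g(z)^d`.
[Robert 2000, Ch. V §4] [folklore] -/
theorem padicEval_pow_of_summable_norm {g : ℚ_[p]⟦X⟧} {z : ℚ_[p]}
    (hg : Summable fun n : ℕ => ‖coeff n g * z ^ n‖) (d : ℕ) :
    (Summable fun n : ℕ => ‖coeff n (g ^ d) * z ^ n‖) ∧ padicEval (g ^ d) z = padicEval g z ^ d := by
  induction d with
  | zero =>
    refine ⟨?_, by rw [pow_zero, pow_zero, padicEval_one]⟩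
    rw [pow_zero]
    refine summable_of_ne_finset_zero (s := {0}) fun n hn => ?_
    rw [Finset.mem_singleton] at hn
    rw [coeff_one, if_neg hn, zero_mul, norm_zero]
  | succ d ih =>
    have h := padicEval_mul_of_summable_norm ih.1 hg
    rw [pow_succ, pow_succ, ← ih.2]
    exact h

/-- **REARRANGEMENT THEOREM.** For `g(0) = 0`, `Σ‖gₙzⁿ‖ < ∞` and ABSOLUTE DOUBLE SUMMABILITY
`Σ_{(d,n)} ‖f_d·[g^d]ₙ·zⁿ‖ < ∞`: the series of `f.subst g` converges absolutely at `z` and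
`(f ∘ g)(z) = Σ_d f_d · g(z)^d`. (No integrality, no open disc: Fubini on `ℕ × ℕ`.)
[Robert 2000, Ch. V §4.2; Bourbaki TG IV] [cite: Robert2000PadicAnalysis, Ch. V §4.2 Proposition 3] -/
theorem padicEval_subst_eq_tsum {f g : ℚ_[p]⟦X⟧} (hg0 : constantCoeff g = 0) {z : ℚ_[p]}
    (hg : Summable fun n : ℕ => ‖coeff n g * z ^ n‖)
    (hT : Summable fun dn : ℕ × ℕ => ‖coeff dn.1 f * (coeff dn.2 (g ^ dn.1) * z ^ dn.2)‖) :
    (Summable fun n : ℕ => ‖coeff n (f.subst g) * z ^ n‖) ∧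
      padicEval (f.subst g) z = ∑' d : ℕ, coeff d f * padicEval g z ^ d := by
  have hTu : Summable (Function.uncurry fun d n : ℕ => coeff d f * (coeff n (g ^ d) * z ^ n)) := hT.of_norm
  -- the coefficient identity `[f∘g]ₙ zⁿ = Σ'_d f_d [g^d]ₙ zⁿ`
  have hcoeff : ∀ n, coeff n (f.subst g) * z ^ n = ∑' d : ℕ, coeff d f * (coeff n (g ^ d) * z ^ n) := by
    intro n
    rw [PSSigmaLineFamilySharpRadius.coeff_subst_eq_sum hg0, Finset.sum_mul]
    rw [tsum_eq_sum (s := Finset.range (n + 1)) (fun d hd => ?_)]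
    · exact Finset.sum_congr rfl fun d _ => by ring
    · rw [Finset.mem_range, not_lt] at hd
      rw [coeff_pow_eq_zero_of_lt hg0 (by omega), zero_mul, mul_zero]
  -- sections of the double family
  have hcol : ∀ n, Summable fun d : ℕ => ‖coeff d f * (coeff n (g ^ d) * z ^ n)‖ := fun n =>
    (hT.prod_symm).prod_factor n
  have hrow : ∀ d, Summable fun n : ℕ => coeff d f * (coeff n (g ^ d) * z ^ n) := fun d =>
    hTu.prod_factor d
  have hcolsum : Summable fun n : ℕ => ∑' d : ℕ, ‖coeff d f * (coeff n (g ^ d) * z ^ n)‖ :=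
    ((summable_prod_of_nonneg (fun _ => norm_nonneg _)).mp (hT.prod_symm)).2
  refine ⟨?_, ?_⟩
  · refine Summable.of_nonneg_of_le (fun n => norm_nonneg _) (fun n => ?_) hcolsum
    rw [hcoeff n]
    exact norm_tsum_le_tsum_norm (hcol n)
  · rw [padicEval]
    simp_rw [hcoeff]
    rw [Summable.tsum_comm' hTu hrow (fun n => (hcol n).of_norm)]
    refine tsum_congr fun d => ?_
    rw [← (padicEval_pow_of_summable_norm hg d).2, padicEval, ← tsum_mul_left]

end Rearrangement

/-! ### §2 The weights of `ε·log²` and the majorant -/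

section Weights

variable {p : ℕ} [Fact p.Prime] (V : WeierstrassCurve ℚ_[p]) [V.IsIntegral ℤ_[p]]

/-- `‖[log_V]ₙ‖ ≤ √p^{n−1}` (`p ≥ 3`), weight form `≤ (√p)⁻¹·√pⁿ`: `[log]ₙ = bₙ/n`, `bₙ` integral,
`p^{v_p n} ≤ √p^{n−1}`. [Silverman AEC IV.6.4] [cite: SilvermanAEC2009, IV.6.4] -/
theorem norm_coeff_formalLog_le_weighted (hp : 3 ≤ p) (n : ℕ) :
    ‖coeff n V.formalLog‖ ≤ (√(p : ℝ))⁻¹ * √(p : ℝ) ^ n := by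
  obtain ⟨h1, hρ, -⟩ := one_le_sqrt_prime (p := p)
  rcases Nat.eq_zero_or_pos n with rfl | hn
  · rw [coeff_zero_eq_constantCoeff_apply, constantCoeff_formalLog, norm_zero]; positivity
  · calc ‖coeff n V.formalLog‖ ≤ ‖((n : ℚ_[p]))⁻¹‖ := norm_coeff_formalLog_le_norm_inv V n
      _ = (p : ℝ) ^ padicValNat p n := norm_inv_natCast (by omega)
      _ ≤ √(p : ℝ) ^ (n - 1) := pow_padicValNat_le_sqrt_pow hp (by omega)
      _ = (√(p : ℝ))⁻¹ * √(p : ℝ) ^ n := by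
        obtain ⟨m, rfl⟩ := Nat.exists_eq_add_of_le' hn
        rw [Nat.add_sub_cancel, pow_succ, mul_comm, mul_assoc, mul_inv_cancel₀ hρ.ne', mul_one]

/-- `‖[ε·log_V²]ₙ‖ ≤ √pⁿ` for `‖ε‖ ≤ p`, `p ≥ 3` (`‖[log²]ₙ‖ ≤ p⁻¹·√pⁿ`). [folklore] -/
theorem norm_coeff_eps_log_sq_le (hp : 3 ≤ p) {ε : ℚ_[p]} (hε : ‖ε‖ ≤ p) (n : ℕ) :
    ‖coeff n (C ε * V.formalLog ^ 2)‖ ≤ 1 * √(p : ℝ) ^ n := by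
  obtain ⟨h1, hρ, h2⟩ := one_le_sqrt_prime (p := p)
  have hL2 := norm_coeff_pow_le_weighted (inv_nonneg.mpr hρ.le) hρ.le
    (norm_coeff_formalLog_le_weighted V hp) 2 n
  rw [coeff_C_mul, norm_mul, one_mul]
  have hinv : ((√(p : ℝ))⁻¹) ^ 2 = (p : ℝ)⁻¹ := by rw [inv_pow, h2]
  rw [hinv] at hL2
  have hp0 : (0 : ℝ) < p := by positivity
  calc ‖ε‖ * ‖coeff n (V.formalLog ^ 2)‖ ≤ (p : ℝ) * ((p : ℝ)⁻¹ * √(p : ℝ) ^ n) := by gcongr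
    _ = √(p : ℝ) ^ n := by rw [← mul_assoc, mul_inv_cancel₀ hp0.ne', one_mul]

omit [V.IsIntegral ℤ_[p]] in
/-- `[tⁿ](ε·log_V²)^d = 0` for `n < 2d` (`t² ∣ ε·log²`). [folklore] -/
theorem coeff_pow_eps_log_sq_eq_zero (ε : ℚ_[p]) {d n : ℕ} (h : n < 2 * d) :
    coeff n ((C ε * V.formalLog ^ 2) ^ d) = 0 := by
  have hX : X ∣ V.formalLog := by rw [X_dvd_iff]; exact constantCoeff_formalLog V
  have hX2 : X ^ 2 ∣ C ε * V.formalLog ^ 2 := (pow_dvd_pow_of_dvd hX 2).mul_left _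
  have hX2d : X ^ (2 * d) ∣ (C ε * V.formalLog ^ 2) ^ d := by
    rw [pow_mul]; exact pow_dvd_pow_of_dvd hX2 d
  exact (X_pow_dvd_iff.mp hX2d) n h

/-- The majorant `G(d,n) = [2d ≤ n]·√p^d·((√p)⁻¹)ⁿ` of the double family. [folklore] -/
theorem norm_term_le_majorant (hp : 3 ≤ p) {ε : ℚ_[p]} (hε : ‖ε‖ ≤ p) {z : ℚ_[p]} (hz : ‖z‖ ≤ (p : ℝ)⁻¹)
    (d n : ℕ) :
    ‖coeff d (exp ℚ_[p]) * (coeff n ((C ε * V.formalLog ^ 2) ^ d) * z ^ n)‖ ≤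
      if 2 * d ≤ n then √(p : ℝ) ^ d * ((√(p : ℝ))⁻¹) ^ n else 0 := by
  obtain ⟨h1, hρ, h2⟩ := one_le_sqrt_prime (p := p)
  obtain ⟨hmul, -⟩ := sqrt_mul_inv_prime (p := p)
  split_ifs with hdn
  · rw [norm_mul, norm_mul, norm_pow, coeff_exp]
    have hfac : ‖algebraMap ℚ ℚ_[p] (1 / (d ! : ℚ))‖ = (p : ℝ) ^ padicValNat p d ! := by
      rw [map_div₀, map_one, map_natCast, one_div, norm_inv_natCast (Nat.factorial_ne_zero d)]
    have h3 : (p : ℝ) ^ padicValNat p d ! ≤ √(p : ℝ) ^ d := by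
      rw [show (p : ℝ) ^ padicValNat p d ! = √(p : ℝ) ^ (2 * padicValNat p d !) by rw [pow_mul, h2]]
      exact pow_le_pow_right₀ h1 (two_mul_padicValNat_factorial_le hp d)
    have hΦ := norm_coeff_pow_le_weighted zero_le_one hρ.le (norm_coeff_eps_log_sq_le V hp hε) d n
    rw [one_pow, one_mul] at hΦ
    rw [hfac]
    calc (p : ℝ) ^ padicValNat p d ! * (‖coeff n ((C ε * V.formalLog ^ 2) ^ d)‖ * ‖z‖ ^ n)
        ≤ √(p : ℝ) ^ d * (√(p : ℝ) ^ n * ((p : ℝ)⁻¹) ^ n) := by gcongr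
      _ = √(p : ℝ) ^ d * ((√(p : ℝ))⁻¹) ^ n := by rw [← mul_pow, hmul]
  · rw [coeff_pow_eps_log_sq_eq_zero V ε (by omega), zero_mul, mul_zero, norm_zero]

/-- Row sums of the majorant: `Σ_n G(d,n) = ((√p)⁻¹)^d · (1 − (√p)⁻¹)⁻¹`. [folklore] -/
theorem hasSum_majorant_row (d : ℕ) :
    HasSum (fun n : ℕ => if 2 * d ≤ n then √(p : ℝ) ^ d * ((√(p : ℝ))⁻¹) ^ n else 0)
      (((√(p : ℝ))⁻¹) ^ d * (1 - (√(p : ℝ))⁻¹)⁻¹) := by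
  obtain ⟨h1, hρ, h2⟩ := one_le_sqrt_prime (p := p)
  obtain ⟨-, hlt⟩ := sqrt_mul_inv_prime (p := p)
  have hr0 : 0 ≤ (√(p : ℝ))⁻¹ := inv_nonneg.mpr hρ.le
  -- shift by `2d`: the first `2d` terms vanish
  have hgeo : HasSum (fun m : ℕ => √(p : ℝ) ^ d * ((√(p : ℝ))⁻¹) ^ (m + 2 * d))
      (((√(p : ℝ))⁻¹) ^ d * (1 - (√(p : ℝ))⁻¹)⁻¹) := by
    have hone : √(p : ℝ) ^ d * ((√(p : ℝ))⁻¹) ^ d = 1 := by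
      rw [← mul_pow, mul_inv_cancel₀ hρ.ne', one_pow]
    have hkey : ∀ m : ℕ, √(p : ℝ) ^ d * ((√(p : ℝ))⁻¹) ^ (m + 2 * d) =
        ((√(p : ℝ))⁻¹) ^ d * ((√(p : ℝ))⁻¹) ^ m := by
      intro m
      calc √(p : ℝ) ^ d * ((√(p : ℝ))⁻¹) ^ (m + 2 * d)
          = (√(p : ℝ) ^ d * ((√(p : ℝ))⁻¹) ^ d) * (((√(p : ℝ))⁻¹) ^ d * ((√(p : ℝ))⁻¹) ^ m) := by
            rw [pow_add, two_mul, pow_add]; ring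
        _ = ((√(p : ℝ))⁻¹) ^ d * ((√(p : ℝ))⁻¹) ^ m := by rw [hone, one_mul]
    simp_rw [hkey]
    exact (hasSum_geometric_of_lt_one hr0 hlt).mul_left _
  rw [← hasSum_nat_add_iff' (2 * d)]
  have hzero : ∑ i ∈ Finset.range (2 * d),
      (if 2 * d ≤ i then √(p : ℝ) ^ d * ((√(p : ℝ))⁻¹) ^ i else 0) = 0 :=
    Finset.sum_eq_zero fun i hi => by rw [Finset.mem_range] at hi; rw [if_neg (by omega)]
  rw [hzero, sub_zero]
  have hfun : (fun n : ℕ => if 2 * d ≤ n + 2 * d then √(p : ℝ) ^ d * ((√(p : ℝ))⁻¹) ^ (n + 2 * d) else 0) =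
      fun m : ℕ => √(p : ℝ) ^ d * ((√(p : ℝ))⁻¹) ^ (m + 2 * d) := by
    funext m; rw [if_pos (by omega)]
  rw [hfun]
  exact hgeo

/-- The majorant is summable on `ℕ × ℕ`. [folklore] -/
theorem summable_majorant :
    Summable fun dn : ℕ × ℕ =>
      if 2 * dn.1 ≤ dn.2 then √(p : ℝ) ^ dn.1 * ((√(p : ℝ))⁻¹) ^ dn.2 else (0 : ℝ) := by
  obtain ⟨h1, hρ, h2⟩ := one_le_sqrt_prime (p := p)
  obtain ⟨-, hlt⟩ := sqrt_mul_inv_prime (p := p)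
  have hr0 : 0 ≤ (√(p : ℝ))⁻¹ := inv_nonneg.mpr hρ.le
  refine (summable_prod_of_nonneg fun dn => ?_).mpr ⟨fun d => (hasSum_majorant_row (p := p) d).summable, ?_⟩
  · dsimp only
    split_ifs
    · positivity
    · exact le_rfl
  · simp_rw [(hasSum_majorant_row (p := p) _).tsum_eq]
    exact (summable_geometric_of_lt_one hr0 hlt).mul_right _

/-- **Absolute double summability** of `Σ_{d,n} (1/d!)·[(ε log²)^d]ₙ·zⁿ` for `‖z‖ ≤ p⁻¹`, `‖ε‖ ≤ p`,
`p ≥ 3`. [Robert 2000, Ch. V §4.2] [folklore] -/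
theorem summable_double (hp : 3 ≤ p) {ε : ℚ_[p]} (hε : ‖ε‖ ≤ p) {z : ℚ_[p]} (hz : ‖z‖ ≤ (p : ℝ)⁻¹) :
    Summable fun dn : ℕ × ℕ =>
      ‖coeff dn.1 (exp ℚ_[p]) * (coeff dn.2 ((C ε * V.formalLog ^ 2) ^ dn.1) * z ^ dn.2)‖ :=
  Summable.of_nonneg_of_le (fun _ => norm_nonneg _) (fun dn => norm_term_le_majorant V hp hε hz dn.1 dn.2)
    summable_majorant

/-- `Σ‖[log_V]ₙ zⁿ‖ < ∞` for `‖z‖ ≤ p⁻¹`, `p ≥ 3`. [Silverman AEC IV.6.4] [cite: SilvermanAEC2009, IV.6.4] -/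
theorem summable_norm_formalLog_of_norm_le (hp : 3 ≤ p) {z : ℚ_[p]} (hz : ‖z‖ ≤ (p : ℝ)⁻¹) :
    Summable fun n : ℕ => ‖coeff n V.formalLog * z ^ n‖ := by
  obtain ⟨h1, hρ, h2⟩ := one_le_sqrt_prime (p := p)
  obtain ⟨hmul, hlt⟩ := sqrt_mul_inv_prime (p := p)
  have hr0 : 0 ≤ (√(p : ℝ))⁻¹ := inv_nonneg.mpr hρ.le
  refine Summable.of_nonneg_of_le (fun n => norm_nonneg _) (fun n => ?_)
    ((summable_geometric_of_lt_one hr0 hlt).mul_left (√(p : ℝ))⁻¹)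
  rw [norm_mul, norm_pow]
  calc ‖coeff n V.formalLog‖ * ‖z‖ ^ n ≤ ((√(p : ℝ))⁻¹ * √(p : ℝ) ^ n) * ((p : ℝ)⁻¹) ^ n := by
        gcongr; exact norm_coeff_formalLog_le_weighted V hp n
    _ = (√(p : ℝ))⁻¹ * ((√(p : ℝ))⁻¹) ^ n := by rw [mul_assoc, ← mul_pow, hmul]

/-- **`‖log_V(z)‖ = ‖z‖` on the closed disc `‖z‖ ≤ p⁻¹`** (`p ≥ 3`): `log_V(z) = z + η`,
`‖η‖ ≤ (√p)⁻¹·‖z‖`. [Silverman AEC IV.6.4(b)] [cite: SilvermanAEC2009, IV.6.4] -/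
theorem norm_padicEval_formalLog_of_norm_le (hp : 3 ≤ p) {z : ℚ_[p]} (hz : ‖z‖ ≤ (p : ℝ)⁻¹) :
    ‖padicEval V.formalLog z‖ = ‖z‖ := by
  obtain ⟨h1, hρ, h2⟩ := one_le_sqrt_prime (p := p)
  obtain ⟨hmul, hlt⟩ := sqrt_mul_inv_prime (p := p)
  have hsum := (summable_norm_formalLog_of_norm_le V hp hz).of_norm
  rcases eq_or_ne z 0 with rfl | hz0
  · rw [norm_zero, norm_eq_zero, padicEval, tsum_eq_single 0 fun n hn => ?_]
    · rw [pow_zero, mul_one, coeff_zero_eq_constantCoeff_apply, constantCoeff_formalLog]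
    · rw [zero_pow hn, mul_zero]
  have hzpos : 0 < ‖z‖ := norm_pos_iff.mpr hz0
  have hsplit : padicEval V.formalLog z = z + ∑' n : ℕ, coeff (n + 2) V.formalLog * z ^ (n + 2) := by
    rw [padicEval, hsum.tsum_eq_zero_add, ((summable_nat_add_iff 1).mpr hsum).tsum_eq_zero_add,
      coeff_zero_eq_constantCoeff_apply, constantCoeff_formalLog, coeff_one_formalLog]
    simp only [zero_add, pow_zero, mul_one, pow_one, one_mul]
  have hη : ‖∑' n : ℕ, coeff (n + 2) V.formalLog * z ^ (n + 2)‖ ≤ (√(p : ℝ))⁻¹ * ‖z‖ := by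
    refine IsUltrametricDist.norm_tsum_le_of_forall_le_of_nonneg (by positivity) fun n => ?_
    rw [norm_mul, norm_pow, pow_succ]
    have hc := norm_coeff_formalLog_le_weighted V hp (n + 2)
    calc ‖coeff (n + 2) V.formalLog‖ * (‖z‖ ^ (n + 1) * ‖z‖)
        ≤ ((√(p : ℝ))⁻¹ * √(p : ℝ) ^ (n + 2)) * (((p : ℝ)⁻¹) ^ (n + 1) * ‖z‖) := by gcongr
      _ = ((√(p : ℝ))⁻¹) ^ (n + 1) * ‖z‖ := by
        rw [show (√(p : ℝ))⁻¹ * √(p : ℝ) ^ (n + 2) = √(p : ℝ) ^ (n + 1) by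
          rw [inv_mul_eq_iff_eq_mul₀ hρ.ne', ← pow_succ'],
          ← mul_assoc, ← mul_pow, hmul]
      _ ≤ (√(p : ℝ))⁻¹ * ‖z‖ := by
        rw [pow_succ']
        exact mul_le_mul_of_nonneg_right (mul_le_of_le_one_right (inv_nonneg.mpr hρ.le)
          (pow_le_one₀ (inv_nonneg.mpr hρ.le) hlt.le)) hzpos.le
  have hlt' : ‖∑' n : ℕ, coeff (n + 2) V.formalLog * z ^ (n + 2)‖ < ‖z‖ :=
    hη.trans_lt (by
      calc (√(p : ℝ))⁻¹ * ‖z‖ < 1 * ‖z‖ := mul_lt_mul_of_pos_right hlt hzpos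
        _ = ‖z‖ := one_mul _)
  rw [hsplit, IsUltrametricDist.norm_add_eq_max_of_norm_ne_norm (ne_of_gt hlt'), max_eq_left hlt'.le]

end Weights

/-! ### §3 The exp-factor at the boundary -/

section ExpFactor

variable {p : ℕ} [Fact p.Prime] (V : WeierstrassCurve ℚ_[p]) [V.IsIntegral ℤ_[p]]

/-- **THE EXP FACTOR AT THE BOUNDARY**: for `‖z‖ ≤ p⁻¹`, `‖ε‖ ≤ p`, `p ≥ 3`: the series of
`exp(ε·log_V²)` converges absolutely at `z` and `(exp(ε log_V²))(z) = exp_p(ε·log_V(z)²)`.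
[Robert 2000, Ch. V §4.2] [cite: Robert2000PadicAnalysis, Ch. V §4.2 Proposition 3] -/
theorem padicEval_exp_formalLog_sq_of_norm_le (hp : 3 ≤ p) {ε : ℚ_[p]} (hε : ‖ε‖ ≤ p) {z : ℚ_[p]}
    (hz : ‖z‖ ≤ (p : ℝ)⁻¹) :
    (Summable fun n : ℕ => ‖coeff n ((exp ℚ_[p]).subst (C ε * V.formalLog ^ 2)) * z ^ n‖) ∧
      padicEval ((exp ℚ_[p]).subst (C ε * V.formalLog ^ 2)) z =
        NormedSpace.exp (ε * padicEval V.formalLog z ^ 2) := by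
  have hL := summable_norm_formalLog_of_norm_le V hp hz
  have hL2 := padicEval_pow_of_summable_norm hL 2
  have hΦ : Summable fun n : ℕ => ‖coeff n (C ε * V.formalLog ^ 2) * z ^ n‖ := by
    have : (fun n : ℕ => ‖coeff n (C ε * V.formalLog ^ 2) * z ^ n‖) =
        fun n : ℕ => ‖ε‖ * ‖coeff n (V.formalLog ^ 2) * z ^ n‖ := by
      funext n; rw [coeff_C_mul, mul_assoc, norm_mul]
    rw [this]; exact hL2.1.mul_left _
  obtain ⟨hsum, heval⟩ := padicEval_subst_eq_tsum (PSSigmaLineFamily.constantCoeff_C_mul_formalLog_sq V ε) hΦ (summable_double V hp hε hz)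
  refine ⟨hsum, ?_⟩
  rw [heval, NormedSpace.exp_eq_tsum ℚ_[p], padicEval_C_mul', hL2.2]
  refine tsum_congr fun d => ?_
  rw [coeff_exp, smul_eq_mul, map_div₀, map_one, map_natCast, one_div]

/-- `‖ε·log_V(z)²‖ < r_p = p^{−1/(p−1)}` at the boundary (`‖z‖ ≤ p⁻¹`, `‖ε‖ ≤ p`, `p ≥ 3`):
the value is `≤ p⁻¹`. [Robert 2000, Ch. V §4.1] [cite: Robert2000PadicAnalysis, Ch. V §4.1 Theorem] -/
theorem norm_eps_mul_log_sq_lt_radius_of_norm_le (hp : 3 ≤ p) {ε : ℚ_[p]} (hε : ‖ε‖ ≤ p) {z : ℚ_[p]}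
    (hz : ‖z‖ ≤ (p : ℝ)⁻¹) :
    ‖ε * padicEval V.formalLog z ^ 2‖ < (p : ℝ) ^ (-(1 : ℝ) / ((p : ℝ) - 1)) := by
  have hp1 : (1 : ℝ) < p := by exact_mod_cast (show 1 < p by omega)
  have hp0 : (0 : ℝ) < p := by positivity
  have hL : ‖padicEval V.formalLog z‖ ≤ (p : ℝ)⁻¹ := by rw [norm_padicEval_formalLog_of_norm_le V hp hz]; exact hz
  have hval : ‖ε * padicEval V.formalLog z ^ 2‖ ≤ (p : ℝ)⁻¹ := by
    rw [norm_mul, norm_pow]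
    calc ‖ε‖ * ‖padicEval V.formalLog z‖ ^ 2 ≤ (p : ℝ) * ((p : ℝ)⁻¹) ^ 2 := by gcongr
      _ = (p : ℝ)⁻¹ := by rw [sq, ← mul_assoc, mul_inv_cancel₀ hp0.ne', one_mul]
  refine hval.trans_lt ?_
  rw [← Real.rpow_neg_one, Real.rpow_lt_rpow_left_iff hp1]
  have h2 : (2 : ℝ) ≤ (p : ℝ) - 1 := by
    have : (3 : ℝ) ≤ p := by exact_mod_cast hp
    linarith
  rw [neg_div, neg_lt_neg_iff, div_lt_one (by linarith)]
  linarith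

/-- **`log_p((exp(ε log_V²))(z)) = ε·log_V(z)²` at the boundary.** [Robert 2000, Ch. V §4.2 Proposition 3]
[cite: Robert2000PadicAnalysis, Ch. V §4.2 Proposition 3] -/
theorem padicLog_padicEval_exp_formalLog_sq_of_norm_le (hp : 3 ≤ p) {ε : ℚ_[p]} (hε : ‖ε‖ ≤ p)
    {z : ℚ_[p]} (hz : ‖z‖ ≤ (p : ℝ)⁻¹) :
    padicLog p (padicEval ((exp ℚ_[p]).subst (C ε * V.formalLog ^ 2)) z) =
      ε * padicEval V.formalLog z ^ 2 := by
  rw [(padicEval_exp_formalLog_sq_of_norm_le V hp hε hz).2]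
  exact padicLog_exp_of_norm_lt_radius (norm_eps_mul_log_sq_lt_radius_of_norm_le V hp hε hz)

/-- The exp-factor value is non-zero at the boundary. [cite: Robert2000PadicAnalysis, Ch. V §4.2 Proposition 3] -/
theorem padicEval_exp_formalLog_sq_ne_zero_of_norm_le (hp : 3 ≤ p) {ε : ℚ_[p]} (hε : ‖ε‖ ≤ p)
    {z : ℚ_[p]} (hz : ‖z‖ ≤ (p : ℝ)⁻¹) :
    padicEval ((exp ℚ_[p]).subst (C ε * V.formalLog ^ 2)) z ≠ 0 := by
  rw [(padicEval_exp_formalLog_sq_of_norm_le V hp hε hz).2]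
  exact exp_ne_zero_of_norm_lt_radius (p := p) (norm_eps_mul_log_sq_lt_radius_of_norm_le V hp hε hz)

end ExpFactor

end Summit.BirchSwinnertonDyer.BirchSwinnertonDyer.Theorems.PSSigmaLineFamilyBoundaryEvaluation

end
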